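/-
Copyright (c) 2026 the pub-hodgecm-mathlib formalisation cell (harness21).  Prover seat hodgecm-mathlib-F0P3-p03 (g12) — (U) road, U4-DISCHARGE (W2)-(n2)-TRANSPORT, FILE (ii)
«(R1G) with an EXPLICIT constant for the top-form block measure», 2026-09-01.
-/
import Literature.NumberTheory.Automorphic.ArchRankOneLimitFormulaGroup            -- ★ p840661 (R1G): `tendsto_deriv_two_sin_smul_integral_conj_of_chart_identity`; brings ★ HAT-BOX (H2a)(H2b)
import Literature.NumberTheory.Weil1964.UnitaryArchLocalTopFormHaarCongrTransport   -- ★ p844937 (this seat) FILE (i): `map_conj_archLocalTopFormHaar`, `map_archLocalTopFormHaar_neg`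
import HarnessLib

/-!
# Harish-Chandra's limit formula on `U(e₀,e₁)` (`e₀e₁ < 0`) for the TOP-FORM Haar measure, with an EXPLICIT constant: `−π·C`, `C` the disc constant of the top-form measure
# of the standard `U(1,1)` ((U) road, U4-DISCHARGE (W2) = MEMO-U4-NC-v1 (n2)-transport + (n4)-(R1G); Rogawski 1990 §8.2 Prop. 8.2.1 p. 118, Varadarajan 1989 §6.4 Thm 22)

Topic `NumberTheory/Automorphic`; namespace `Literature.NumberTheory.Automorphic.UnitaryGroup`.  THEOREMS ONLY (no `def`, no instance, no notation, no axiom, no named fact,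
no `sorry`).  Cell `pub/hodgecm-mathlib`, crux H413 = `stmt-HodgeConjecture-24833` (supports only).  Count-neutral.
HONEST LABEL: HC_CM is proved only modulo the 2 remaining named inputs (hLiu418 24832, h413 24833) until rung 0 closes; this file pays nothing by itself.

WHAT.  ★ (R1G) `exists_tendsto_deriv_two_sin_smul_orbitalIntegral` gives the rank-one limit formula on `G₂ = U(σ, diag(σ a))` with `∃ C ≠ 0` depending on the Haar measure `μ₂`.
The (W2) assembler ★ p844887 `archLimitFormulaNoncompactWall_clause_wallBlockMap … (C) (hR)` (A-p19 (g24)) takes that formula for the SPECIFIC block measure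
`μ₂ = archLocalTopFormHaar L 2 (diagonal ![α 0, α 2]) w` with a NAMED constant `C` (binder `hR`), and U4's (nc) constant `−V₂·V₁` then reads `V₁ · C = −V₂·V₁`, i.e. `C = −V₂`.
THIS FILE produces `hR` BY NAME with **`C = −π · C_d`**, where `C_d` is the disc constant of the top-form measure of the STANDARD group:
`(localTopFormHaar 2 (diagonal ![1,−1])).map (h ↦ h₁₀∕h₀₀) = C_d • μ_hyp` (binder `hC`; its value `C_d = π²∕2 = V₂∕π` is A-p06 (g29)'s FILE 5 `UnitaryArchTopFormDiscConstant` —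
then `C = −π³∕2 = −V₂` with ★ A-p12 (g20) `lintegral_cayleyWeightC_two`).
* §1 `tendsto_deriv_orbitalIntegral_transport_explicit` — ★ (R1G) §2 `tendsto_deriv_orbitalIntegral_transport` re-run token for token with the witness EXPOSED: the formula for
  ONE measure `μ'.map e` on `S` with constant `C` gives the formula for `μ'` on `S′` with the SAME `C` (`e : S′ ≃ₜ* S` conjugation by a torus-commuting `T`).
* §2 `tendsto_deriv_two_sin_smul_orbitalIntegral_of_map_chart` — on the standard `U(diag(1,−1))`: `π_* μ = C_d • μ_hyp` ⟹ the formula for `μ` with constant `−π·C_d`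
  (★ HAT-BOX deterministic `integral_comp_conj_diag_eq_smul_integral_chart`, `C₁ = C_d∕2`, + ★ (R1G) §1 core, `−2π·C₁`).
* §3 **`tendsto_deriv_two_sin_smul_orbitalIntegral_archLocalTopFormHaar`** — CM field `L`, complex place `w`, `a : Fin 2 → L` real non-zero with `re σ_w(a₀) · re σ_w(a₁) < 0`:
  the formula for `archLocalTopFormHaar L 2 (diagonal a) w` with constant `−π·C_d`.  Transport: `T = diag(√|e₀|, √|e₁|)` carries `μ^TF_w(diag a)` to `μ^TF_w(diag(±1,∓1))`
  (★ FILE (i) `map_conj_archLocalTopFormHaar` — hypothesis-free), `U(−J) = U(J)` at the measure level (★ `map_archLocalTopFormHaar_neg`), and the carrier rewrite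
  `σ_w(diag(1,−1)) = diag(1,−1)`.

## References
* [Varadarajan1989] V. S. Varadarajan, *An Introduction to Harmonic Analysis on Semisimple Lie Groups* (1989), §6.4 Thm 22, Lemma 21.
* [Rogawski1990] J. D. Rogawski, *Automorphic Representations of Unitary Groups in Three Variables*, Ann. of Math. Stud. 123 (1990), §8.2 Prop. 8.2.1 p. 118; §1.7 p. 6; §3.8 p. 30.
* [Helgason2000] S. Helgason, *Groups and Geometric Analysis*, AMS Math. Surveys Monogr. 83 (2000), Introduction §4 Thm. 4.2.
-/

set_option autoImplicit false

noncomputable section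

namespace Literature.NumberTheory.Automorphic.UnitaryGroup

open _root_.MeasureTheory _root_.MeasureTheory.Measure Set Filter _root_.Topology _root_.Complex _root_.NumberField _root_.NumberField.InfinitePlace
open Literature.Analysis.Complex Literature.NumberTheory.Weil1964.UnitaryArchLocalTopForm
open scoped Real _root_.Matrix Matrix.Norms.Operator MatrixGroups _root_.NNReal _root_.ENNReal

variable {E : Type*} [NormedAddCommGroup E] [NormedSpace ℝ E] [CompleteSpace E]

/-! ## §1 Transport along a torus-commuting conjugation, explicit constant -/

omit [CompleteSpace E] in
/-- The test function transported by `Ad(T⁻¹)`, `X ↦ f(T⁻¹ X T)`, is again `C¹` with compact support (★ (R1G) §2, private there; re-proved). [cite: Varadarajan1989, §6.4 Thm 22] -/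
private theorem contDiff_hasCompactSupport_comp_conj' (T : GL (Fin 2) ℂ) {f : Matrix (Fin 2) (Fin 2) ℂ → E}
    (hf : ContDiff ℝ 1 f) (hfc : HasCompactSupport f) :
    ContDiff ℝ 1 (fun X : Matrix (Fin 2) (Fin 2) ℂ =>
        f (((T⁻¹ : GL (Fin 2) ℂ) : Matrix (Fin 2) (Fin 2) ℂ) * X * (T : Matrix (Fin 2) (Fin 2) ℂ))) ∧
      HasCompactSupport (fun X : Matrix (Fin 2) (Fin 2) ℂ =>
        f (((T⁻¹ : GL (Fin 2) ℂ) : Matrix (Fin 2) (Fin 2) ℂ) * X * (T : Matrix (Fin 2) (Fin 2) ℂ))) := by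
  refine ⟨hf.comp ((contDiff_const.mul contDiff_id).mul contDiff_const), ?_⟩
  let φ : Matrix (Fin 2) (Fin 2) ℂ ≃ₜ Matrix (Fin 2) (Fin 2) ℂ :=
    { toFun := fun X => ((T⁻¹ : GL (Fin 2) ℂ) : Matrix (Fin 2) (Fin 2) ℂ) * X * (T : Matrix (Fin 2) (Fin 2) ℂ)
      invFun := fun X => (T : Matrix (Fin 2) (Fin 2) ℂ) * X * ((T⁻¹ : GL (Fin 2) ℂ) : Matrix (Fin 2) (Fin 2) ℂ)
      left_inv := fun X => by
        simp only [← Matrix.mul_assoc, Units.mul_inv, Matrix.one_mul]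
        rw [Matrix.mul_assoc, Units.mul_inv, Matrix.mul_one]
      right_inv := fun X => by
        simp only [← Matrix.mul_assoc, Units.inv_mul, Matrix.one_mul]
        rw [Matrix.mul_assoc, Units.inv_mul, Matrix.mul_one]
      continuous_toFun := (continuous_const.mul continuous_id).mul continuous_const
      continuous_invFun := (continuous_const.mul continuous_id).mul continuous_const }
  exact hfc.comp_homeomorph φ

omit [CompleteSpace E] in
/-- **Transport step, EXPLICIT CONSTANT** (★ (R1G) `tendsto_deriv_orbitalIntegral_transport` with the witness exposed).  `S, S′ ≤ GL₂(ℂ)` contain the circle torus,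
`e : S′ ≃ₜ* S` is conjugation by a `T` commuting with the torus.  If the limit formula with differentiability holds on `S` for THE measure `μ'.map e` with constant `C`,
then it holds on `S′` for `μ'` with the same `C` (test function `X ↦ f(T⁻¹ X T)`, same value at `z • 1`; `h′γh′⁻¹ ↦ T⁻¹ (hγh⁻¹) T`).
[cite: Varadarajan1989, §6.4 Thm 22] [cite: Rogawski1990, §8.2 Prop. 8.2.1 p. 118] -/
theorem tendsto_deriv_orbitalIntegral_transport_explicit (S S' : Subgroup (GL (Fin 2) ℂ)) [MeasurableSpace S] [BorelSpace S]
    [MeasurableSpace S'] [BorelSpace S'] (hS : ∀ w : Fin 2 → Circle, circleDiagonal 2 w ∈ S)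
    (hS' : ∀ w : Fin 2 → Circle, circleDiagonal 2 w ∈ S') (e : S' ≃ₜ* S) (T : GL (Fin 2) ℂ)
    (he : ∀ h' : S', ((e h' : S) : GL (Fin 2) ℂ) = T * (h' : GL (Fin 2) ℂ) * T⁻¹)
    (hT : ∀ w : Fin 2 → Circle, T * circleDiagonal 2 w = circleDiagonal 2 w * T)
    (μ' : Measure S') (C : ℝ)
    (hL : ∀ (f : Matrix (Fin 2) (Fin 2) ℂ → E), ContDiff ℝ 1 f → HasCompactSupport f → ∀ z : Circle,
        Tendsto (fun ψ : ℝ => deriv (fun ψ : ℝ => (2 * Real.sin ψ) •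
            ∫ h : S, f (((h * ⟨circleDiagonal 2 ![z * Circle.exp ψ, z * Circle.exp (-ψ)], hS _⟩ * h⁻¹ : S) :
              GL (Fin 2) ℂ) : Matrix (Fin 2) (Fin 2) ℂ) ∂(μ'.map e)) ψ)
          (𝓝[≠] 0) (𝓝 (C • f ((z : ℂ) • (1 : Matrix (Fin 2) (Fin 2) ℂ)))) ∧
        ∀ ψ ∈ Ioo (-1 : ℝ) 1, ψ ≠ 0 → DifferentiableAt ℝ (fun ψ : ℝ => (2 * Real.sin ψ) •
            ∫ h : S, f (((h * ⟨circleDiagonal 2 ![z * Circle.exp ψ, z * Circle.exp (-ψ)], hS _⟩ * h⁻¹ : S) :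
              GL (Fin 2) ℂ) : Matrix (Fin 2) (Fin 2) ℂ) ∂(μ'.map e)) ψ) :
    ∀ (f : Matrix (Fin 2) (Fin 2) ℂ → E), ContDiff ℝ 1 f → HasCompactSupport f → ∀ z : Circle,
        Tendsto (fun ψ : ℝ => deriv (fun ψ : ℝ => (2 * Real.sin ψ) •
            ∫ h : S', f (((h * ⟨circleDiagonal 2 ![z * Circle.exp ψ, z * Circle.exp (-ψ)], hS' _⟩ * h⁻¹ : S') :
              GL (Fin 2) ℂ) : Matrix (Fin 2) (Fin 2) ℂ) ∂μ') ψ)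
          (𝓝[≠] 0) (𝓝 (C • f ((z : ℂ) • (1 : Matrix (Fin 2) (Fin 2) ℂ)))) ∧
        ∀ ψ ∈ Ioo (-1 : ℝ) 1, ψ ≠ 0 → DifferentiableAt ℝ (fun ψ : ℝ => (2 * Real.sin ψ) •
            ∫ h : S', f (((h * ⟨circleDiagonal 2 ![z * Circle.exp ψ, z * Circle.exp (-ψ)], hS' _⟩ * h⁻¹ : S') :
              GL (Fin 2) ℂ) : Matrix (Fin 2) (Fin 2) ℂ) ∂μ') ψ := by
  intro f hf hfc z
  obtain ⟨hfT, hfTc⟩ := contDiff_hasCompactSupport_comp_conj' (E := E) T hf hfc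
  obtain ⟨hlim, hdiff⟩ := hL _ hfT hfTc z
  -- the integrals agree for every `ψ`
  have key : (fun ψ : ℝ => (2 * Real.sin ψ) •
      ∫ h : S', f (((h * ⟨circleDiagonal 2 ![z * Circle.exp ψ, z * Circle.exp (-ψ)], hS' _⟩ * h⁻¹ : S') :
        GL (Fin 2) ℂ) : Matrix (Fin 2) (Fin 2) ℂ) ∂μ') =
      fun ψ : ℝ => (2 * Real.sin ψ) •
        ∫ h : S, (fun X : Matrix (Fin 2) (Fin 2) ℂ =>
            f (((T⁻¹ : GL (Fin 2) ℂ) : Matrix (Fin 2) (Fin 2) ℂ) * X * (T : Matrix (Fin 2) (Fin 2) ℂ)))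
          (((h * ⟨circleDiagonal 2 ![z * Circle.exp ψ, z * Circle.exp (-ψ)], hS _⟩ * h⁻¹ : S) :
            GL (Fin 2) ℂ) : Matrix (Fin 2) (Fin 2) ℂ) ∂(μ'.map e) := by
    funext ψ
    congr 1
    rw [show (Measure.map (⇑e) μ' : Measure S) = Measure.map (⇑e.toHomeomorph.toMeasurableEquiv) μ' from rfl,
      integral_map_equiv]
    refine integral_congr_ae (Eventually.of_forall fun h' => ?_)
    change f _ = f (((T⁻¹ : GL (Fin 2) ℂ) : Matrix (Fin 2) (Fin 2) ℂ) *
      (((e h' * ⟨circleDiagonal 2 ![z * Circle.exp ψ, z * Circle.exp (-ψ)], hS _⟩ * (e h')⁻¹ : S) :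
        GL (Fin 2) ℂ) : Matrix (Fin 2) (Fin 2) ℂ) * (T : Matrix (Fin 2) (Fin 2) ℂ))
    have hc : T⁻¹ * circleDiagonal 2 ![z * Circle.exp ψ, z * Circle.exp (-ψ)] * T =
        circleDiagonal 2 ![z * Circle.exp ψ, z * Circle.exp (-ψ)] := by
      rw [mul_assoc, ← hT, ← mul_assoc, inv_mul_cancel, one_mul]
    have hGL : T⁻¹ * (((e h' * ⟨circleDiagonal 2 ![z * Circle.exp ψ, z * Circle.exp (-ψ)], hS _⟩ * (e h')⁻¹ : S) :
        GL (Fin 2) ℂ)) * T =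
        ((h' * ⟨circleDiagonal 2 ![z * Circle.exp ψ, z * Circle.exp (-ψ)], hS' _⟩ * h'⁻¹ : S') : GL (Fin 2) ℂ) := by
      simp only [Subgroup.coe_mul, Subgroup.coe_inv, he]
      calc T⁻¹ * (T * (h' : GL (Fin 2) ℂ) * T⁻¹ * circleDiagonal 2 ![z * Circle.exp ψ, z * Circle.exp (-ψ)] *
            (T * (h' : GL (Fin 2) ℂ) * T⁻¹)⁻¹) * T
          = (h' : GL (Fin 2) ℂ) * (T⁻¹ * circleDiagonal 2 ![z * Circle.exp ψ, z * Circle.exp (-ψ)] * T) *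
              (h' : GL (Fin 2) ℂ)⁻¹ := by group
        _ = (h' : GL (Fin 2) ℂ) * circleDiagonal 2 ![z * Circle.exp ψ, z * Circle.exp (-ψ)] *
              (h' : GL (Fin 2) ℂ)⁻¹ := by rw [hc]
    rw [← hGL, Units.val_mul, Units.val_mul]
  rw [key]
  exact ⟨by simpa using hlim, hdiff⟩

/-! ## §2 The standard group `U(diag(1,−1))`: from the disc constant to the limit-formula constant `−π·C` -/

/-- **On `U(1,1) = U(diag(1,−1))(ℂ)`: disc constant ⟹ limit-formula constant.**  If `π_* μ = C • μ_hyp` (`π h = h₁₀∕h₀₀`), then for `f ∈ C¹_c(M₂(ℂ), E)`, `z ∈ S¹`: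
`lim_{ψ → 0, ψ ≠ 0} ∂_ψ [2 sin ψ · ∫ f(h·diag(z e^{iψ}, z e^{−iψ})·h⁻¹) dμ] = (−π·C) • f(z•1)` with differentiability on `0 < |ψ| < 1` (★ HAT-BOX deterministic form, `C₁ = C∕2`;
★ (R1G) §1 core, `−2π·C₁`). [cite: Varadarajan1989, §6.4 Thm 22] [cite: Helgason2000, Introduction §4 Thm. 4.2] [cite: Rogawski1990, §8.2 Prop. 8.2.1 p. 118] -/
theorem tendsto_deriv_two_sin_smul_orbitalIntegral_of_map_chart
    [MeasurableSpace (unitaryGroupOfForm (starRingEnd ℂ) (Matrix.diagonal ![(1 : ℂ), -1]))] [BorelSpace (unitaryGroupOfForm (starRingEnd ℂ) (Matrix.diagonal ![(1 : ℂ), -1]))]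
    (μ : Measure (unitaryGroupOfForm (starRingEnd ℂ) (Matrix.diagonal ![(1 : ℂ), -1]))) (C : ℝ≥0)
    (hC : μ.map (fun h : unitaryGroupOfForm (starRingEnd ℂ) (Matrix.diagonal ![(1 : ℂ), -1]) => discMoebius ((h : GL (Fin 2) ℂ) : Matrix (Fin 2) (Fin 2) ℂ) 0) =
      C • discHyperbolicMeasure)
    (f : Matrix (Fin 2) (Fin 2) ℂ → E) (hf : ContDiff ℝ 1 f) (hfc : HasCompactSupport f) (z : Circle) :
    Tendsto (fun ψ : ℝ => deriv (fun ψ : ℝ => (2 * Real.sin ψ) •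
        ∫ h : unitaryGroupOfForm (starRingEnd ℂ) (Matrix.diagonal ![(1 : ℂ), -1]),
          f (((h * ⟨circleDiagonal 2 ![z * Circle.exp ψ, z * Circle.exp (-ψ)], circleDiagonal_mem_unitaryGroupOfForm_diagonal 2 _ _⟩ * h⁻¹ :
            unitaryGroupOfForm (starRingEnd ℂ) (Matrix.diagonal ![(1 : ℂ), -1])) : GL (Fin 2) ℂ) : Matrix (Fin 2) (Fin 2) ℂ) ∂μ) ψ)
      (𝓝[≠] 0) (𝓝 ((-(π * C)) • f ((z : ℂ) • (1 : Matrix (Fin 2) (Fin 2) ℂ)))) ∧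
    ∀ ψ ∈ Ioo (-1 : ℝ) 1, ψ ≠ 0 → DifferentiableAt ℝ (fun ψ : ℝ => (2 * Real.sin ψ) •
        ∫ h : unitaryGroupOfForm (starRingEnd ℂ) (Matrix.diagonal ![(1 : ℂ), -1]),
          f (((h * ⟨circleDiagonal 2 ![z * Circle.exp ψ, z * Circle.exp (-ψ)], circleDiagonal_mem_unitaryGroupOfForm_diagonal 2 _ _⟩ * h⁻¹ :
            unitaryGroupOfForm (starRingEnd ℂ) (Matrix.diagonal ![(1 : ℂ), -1])) : GL (Fin 2) ℂ) : Matrix (Fin 2) (Fin 2) ℂ) ∂μ) ψ := by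
  have h := tendsto_deriv_two_sin_smul_integral_conj_of_chart_identity (E := E) (unitaryGroupOfForm (starRingEnd ℂ) (Matrix.diagonal ![(1 : ℂ), -1])) μ
    (fun w => circleDiagonal_mem_unitaryGroupOfForm_diagonal 2 w _) ((C : ℝ) / 2)
    (fun f hf _ a b _ => integral_comp_conj_diag_eq_smul_integral_chart μ hC f hf a b) f hf hfc z
  have hconst : -(2 * π) * ((C : ℝ) / 2) = -(π * C) := by ring
  rw [hconst] at h
  exact h

/-! ## §3 The top-form block measure at an indefinite real diagonal carrier of a CM unitary group -/

section CM

variable (L : Type) [Field L] [NumberField L] [IsCMField L]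

/-- A diagonal `T ∈ GL₂(ℂ)` commutes with the circle torus (★ (R1G) §3, private there; re-proved). [cite: Rogawski1990, §3.8 p. 30] -/
private theorem diagonal_mul_circleDiagonal_comm' (T : GL (Fin 2) ℂ) (d : Fin 2 → ℂ)
    (hTd : (T : Matrix (Fin 2) (Fin 2) ℂ) = Matrix.diagonal d) (w : Fin 2 → Circle) :
    T * circleDiagonal 2 w = circleDiagonal 2 w * T := by
  apply Units.ext; simp only [Units.val_mul, coe_circleDiagonal, hTd, Matrix.diagonal_mul_diagonal]; congr 1; funext i; ring

omit [NumberField L] [IsCMField L] in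
/-- `σ_w(diag b) = diag(σ_w b)`. [cite: Rogawski1990, §1.7 p. 6] -/
private theorem diagonal_map_embedding (w : {w : InfinitePlace L // IsComplex w}) (b : Fin 2 → L) :
    (Matrix.diagonal b).map w.1.embedding = Matrix.diagonal (fun i => w.1.embedding (b i)) :=
  Matrix.diagonal_map (map_zero _)

/-- **THE TRANSPORT DATUM.**  For `a : Fin 2 → L` real non-zero with `re σ_w(a₀) · re σ_w(a₁) < 0` there are a DIAGONAL `T ∈ GL₂(ℂ)` and a congruence
`Φ : U(σ_w diag a)(ℂ) ≃ₜ* U(σ_w diag(1,−1))(ℂ)`, `↑(Φ g) = T g T⁻¹`, carrying `archLocalTopFormHaar L 2 (diagonal a) w` to `archLocalTopFormHaar L 2 (diagonal ![1,−1]) w`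
(`T = diag(√e₀, √(−e₁))` if `e₀ > 0 > e₁`; `T = diag(√(−e₀), √e₁)` through `U(diag(−1,1)) = U(diag(1,−1))` if `e₀ < 0 < e₁`; ★ FILE (i)).
[cite: Rogawski1990, §1.7 p. 6; §3.8 p. 30] -/
theorem exists_conj_map_archLocalTopFormHaar_eq_std (w : {w : InfinitePlace L // IsComplex w}) (a : Fin 2 → L) (ha : ∀ i, a i ≠ 0)
    (hreal : ∀ i, (w.1.embedding (a i)).im = 0) (hsgn : (w.1.embedding (a 0)).re * (w.1.embedding (a 1)).re < 0)
    [MeasurableSpace (GL (Fin 2) ℂ)] [BorelSpace (GL (Fin 2) ℂ)] :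
    ∃ (T : GL (Fin 2) ℂ) (d : Fin 2 → ℂ) (_ : (T : Matrix (Fin 2) (Fin 2) ℂ) = Matrix.diagonal d)
      (Φ : unitaryGroupOfForm (starRingEnd ℂ) ((Matrix.diagonal a).map w.1.embedding) ≃ₜ*
        unitaryGroupOfForm (starRingEnd ℂ) ((Matrix.diagonal ![(1 : L), -1]).map w.1.embedding)),
      (∀ g : unitaryGroupOfForm (starRingEnd ℂ) ((Matrix.diagonal a).map w.1.embedding),
        ((Φ g : unitaryGroupOfForm (starRingEnd ℂ) ((Matrix.diagonal ![(1 : L), -1]).map w.1.embedding)) : GL (Fin 2) ℂ) = T * (g : GL (Fin 2) ℂ) * T⁻¹) ∧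
      Measure.map Φ (archLocalTopFormHaar L 2 (Matrix.diagonal a) w) = archLocalTopFormHaar L 2 (Matrix.diagonal ![(1 : L), -1]) w := by
  -- hermitian-diagonal data
  have hherm : ∀ i, (IsCMField.complexConj L (a i) : L) = a i := fun i => by
    apply w.1.embedding.injective
    rw [NumberField.IsCMField.complexEmbedding_complexConj, Complex.conj_eq_iff_im, hreal i]
  have hHa : ((Matrix.diagonal a).map (IsCMField.complexConj L))ᵀ = Matrix.diagonal a ∧ IsUnit (Matrix.diagonal a).det :=
    diagonal_map_complexConj_transpose_and_isUnit_det L 2 a ha hherm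
  have hH1 : ((Matrix.diagonal ![(1 : L), -1]).map (IsCMField.complexConj L))ᵀ = Matrix.diagonal ![(1 : L), -1] ∧ IsUnit (Matrix.diagonal ![(1 : L), -1]).det :=
    diagonal_map_complexConj_transpose_and_isUnit_det L 2 ![(1 : L), -1] (fun i => by fin_cases i <;> simp) (fun i => by fin_cases i <;> simp)
  -- the real weights `e₀, e₁`
  set e₀ : ℝ := (w.1.embedding (a 0)).re with he₀
  set e₁ : ℝ := (w.1.embedding (a 1)).re with he₁
  have hH : (Matrix.diagonal a).map w.1.embedding = Matrix.diagonal ![(e₀ : ℂ), (e₁ : ℂ)] := by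
    rw [diagonal_map_embedding]
    congr 1; funext i
    fin_cases i
    · exact Complex.ext (by simp [he₀]) (by simp [hreal 0])
    · exact Complex.ext (by simp [he₁]) (by simp [hreal 1])
  have hstd : (Matrix.diagonal ![(1 : L), -1]).map w.1.embedding = Matrix.diagonal ![(1 : ℂ), -1] := by
    rw [diagonal_map_embedding]
    congr 1; funext i; fin_cases i <;> simp
  have hnegstd : (-Matrix.diagonal ![(1 : L), -1]).map w.1.embedding = Matrix.diagonal ![(-1 : ℂ), 1] := by
    rw [Matrix.map_neg _ (map_neg _) _, hstd, Matrix.diagonal_neg]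
    congr 1; funext i; fin_cases i <;> simp
  have he₀0 : e₀ ≠ 0 := fun h0 => by rw [h0, zero_mul] at hsgn; exact lt_irrefl _ hsgn
  rcases lt_or_gt_of_ne he₀0 with hneg | hpos
  · -- `e₀ < 0 < e₁`: `T = diag(√(−e₀), √e₁)`, `Tᴴ diag(−1,1) T = diag(e₀,e₁)`, then `U(diag(−1,1)) = U(diag(1,−1))` at the measure level
    have he₁ : 0 < e₁ := by nlinarith
    have hdet : (Matrix.diagonal ![((Real.sqrt (-e₀) : ℝ) : ℂ), ((Real.sqrt e₁ : ℝ) : ℂ)]).det ≠ 0 := by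
      rw [Matrix.det_diagonal, Fin.prod_univ_two]
      simp only [Matrix.cons_val_zero, Matrix.cons_val_one]
      exact mul_ne_zero (by exact_mod_cast (Real.sqrt_pos.2 (by linarith)).ne') (by exact_mod_cast (Real.sqrt_pos.2 he₁).ne')
    obtain ⟨T, hT⟩ : ∃ T : GL (Fin 2) ℂ, (T : Matrix (Fin 2) (Fin 2) ℂ) = Matrix.diagonal ![((Real.sqrt (-e₀) : ℝ) : ℂ), ((Real.sqrt e₁ : ℝ) : ℂ)] :=
      ⟨Matrix.GeneralLinearGroup.mkOfDetNeZero _ hdet, rfl⟩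
    have hTJ : formCongr (starRingEnd ℂ) T ((-Matrix.diagonal ![(1 : L), -1]).map w.1.embedding) = (Matrix.diagonal a).map w.1.embedding := by
      rw [hH, hnegstd, formCongr, hT]
      have h0 : ((Real.sqrt (-e₀) : ℝ) : ℂ) * ((Real.sqrt (-e₀) : ℝ) : ℂ) = -(e₀ : ℂ) := by
        rw [← Complex.ofReal_mul, Real.mul_self_sqrt (by linarith)]; push_cast; ring
      have h1 : ((Real.sqrt e₁ : ℝ) : ℂ) * ((Real.sqrt e₁ : ℝ) : ℂ) = (e₁ : ℂ) := by
        rw [← Complex.ofReal_mul, Real.mul_self_sqrt he₁.le]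
      ext i j
      fin_cases i <;> fin_cases j <;>
        simp [Matrix.diagonal_map, Matrix.diagonal_transpose, Matrix.diagonal_mul_diagonal, Complex.conj_ofReal, h0, h1]
    -- step 1: `Ad T` to the carrier `−diag(1,−1)`
    let Φ₁ := unitaryGroupOfFormCongrOfEq (starRingEnd ℂ) T ((-Matrix.diagonal ![(1 : L), -1]).map w.1.embedding) ((Matrix.diagonal a).map w.1.embedding) hTJ
    have hΦ₁ : ∀ g : unitaryGroupOfForm (starRingEnd ℂ) ((Matrix.diagonal a).map w.1.embedding),
        ((Φ₁ g : unitaryGroupOfForm (starRingEnd ℂ) ((-Matrix.diagonal ![(1 : L), -1]).map w.1.embedding)) : GL (Fin 2) ℂ) = T * (g : GL (Fin 2) ℂ) * T⁻¹ :=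
      fun _ => rfl
    have hherm' : ((-Matrix.diagonal ![(1 : L), -1]).map (IsCMField.complexConj L))ᵀ = -Matrix.diagonal ![(1 : L), -1] := by
      rw [Matrix.map_neg _ (map_neg _) _, Matrix.transpose_neg, hH1.1]
    have hdet' : IsUnit (-Matrix.diagonal ![(1 : L), -1]).det := by
      rw [Matrix.det_neg]; exact (isUnit_neg_one.pow _).mul hH1.2
    have hm₁ : Measure.map Φ₁ (archLocalTopFormHaar L 2 (Matrix.diagonal a) w) = archLocalTopFormHaar L 2 (-Matrix.diagonal ![(1 : L), -1]) w :=
      map_conj_archLocalTopFormHaar L 2 (-Matrix.diagonal ![(1 : L), -1]) (Matrix.diagonal a) hherm' hdet' hHa.1 hHa.2 w hTJ Φ₁ hΦ₁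
    -- step 2: `U(−J) = U(J)` at the measure level
    obtain ⟨Φ₂, hΦ₂, hm₂⟩ := map_archLocalTopFormHaar_neg L 2 (Matrix.diagonal ![(1 : L), -1]) hH1.1 hH1.2 w
    refine ⟨T, _, hT, Φ₁.trans Φ₂, fun g => ?_, ?_⟩
    · show ((Φ₂ (Φ₁ g) : unitaryGroupOfForm (starRingEnd ℂ) ((Matrix.diagonal ![(1 : L), -1]).map w.1.embedding)) : GL (Fin 2) ℂ) = T * (g : GL (Fin 2) ℂ) * T⁻¹
      rw [hΦ₂, hΦ₁]
    · -- (term-mode chain: the `archLocal` ∕ `unitaryGroupOfForm` spellings of the block group are only definitionally equal)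
      show Measure.map (⇑Φ₂ ∘ ⇑Φ₁) (archLocalTopFormHaar L 2 (Matrix.diagonal a) w) = _
      exact (Measure.map_map Φ₂.continuous.measurable Φ₁.continuous.measurable).symm.trans
        ((congrArg (Measure.map ⇑Φ₂) hm₁).trans hm₂)
  · -- `e₀ > 0 > e₁`: `T = diag(√e₀, √(−e₁))`, `Tᴴ diag(1,−1) T = diag(e₀,e₁)`
    have he₁ : e₁ < 0 := by nlinarith
    have hdet : (Matrix.diagonal ![((Real.sqrt e₀ : ℝ) : ℂ), ((Real.sqrt (-e₁) : ℝ) : ℂ)]).det ≠ 0 := by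
      rw [Matrix.det_diagonal, Fin.prod_univ_two]
      simp only [Matrix.cons_val_zero, Matrix.cons_val_one]
      exact mul_ne_zero (by exact_mod_cast (Real.sqrt_pos.2 hpos).ne') (by exact_mod_cast (Real.sqrt_pos.2 (by linarith)).ne')
    obtain ⟨T, hT⟩ : ∃ T : GL (Fin 2) ℂ, (T : Matrix (Fin 2) (Fin 2) ℂ) = Matrix.diagonal ![((Real.sqrt e₀ : ℝ) : ℂ), ((Real.sqrt (-e₁) : ℝ) : ℂ)] :=
      ⟨Matrix.GeneralLinearGroup.mkOfDetNeZero _ hdet, rfl⟩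
    have hTJ : formCongr (starRingEnd ℂ) T ((Matrix.diagonal ![(1 : L), -1]).map w.1.embedding) = (Matrix.diagonal a).map w.1.embedding := by
      rw [hH, hstd, formCongr, hT]
      have h0 : ((Real.sqrt e₀ : ℝ) : ℂ) * ((Real.sqrt e₀ : ℝ) : ℂ) = (e₀ : ℂ) := by
        rw [← Complex.ofReal_mul, Real.mul_self_sqrt hpos.le]
      have h1 : ((Real.sqrt (-e₁) : ℝ) : ℂ) * ((Real.sqrt (-e₁) : ℝ) : ℂ) = -(e₁ : ℂ) := by
        rw [← Complex.ofReal_mul, Real.mul_self_sqrt (by linarith)]; push_cast; ring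
      ext i j
      fin_cases i <;> fin_cases j <;>
        simp [Matrix.diagonal_map, Matrix.diagonal_transpose, Matrix.diagonal_mul_diagonal, Complex.conj_ofReal, h0, h1]
    let Φ₁ := unitaryGroupOfFormCongrOfEq (starRingEnd ℂ) T ((Matrix.diagonal ![(1 : L), -1]).map w.1.embedding) ((Matrix.diagonal a).map w.1.embedding) hTJ
    have hΦ₁ : ∀ g : unitaryGroupOfForm (starRingEnd ℂ) ((Matrix.diagonal a).map w.1.embedding),
        ((Φ₁ g : unitaryGroupOfForm (starRingEnd ℂ) ((Matrix.diagonal ![(1 : L), -1]).map w.1.embedding)) : GL (Fin 2) ℂ) = T * (g : GL (Fin 2) ℂ) * T⁻¹ :=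
      fun _ => rfl
    exact ⟨T, _, hT, Φ₁, hΦ₁, map_conj_archLocalTopFormHaar L 2 (Matrix.diagonal ![(1 : L), -1]) (Matrix.diagonal a) hH1.1 hH1.2 hHa.1 hHa.2 w hTJ Φ₁ hΦ₁⟩

/-- **(R1G) FOR THE TOP-FORM BLOCK MEASURE, EXPLICIT CONSTANT** — A-p19 (g24)'s `hR` of ★ `archLimitFormulaNoncompactWall_clause_wallBlockMap` BY NAME.  For a CM field `L`,
a complex place `w`, `a : Fin 2 → L` real non-zero with `re σ_w(a₀) · re σ_w(a₁) < 0`, and the disc constant `C` of the standard top-form measure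
(`hC : (localTopFormHaar 2 (diagonal ![1,−1])).map (h ↦ h₁₀∕h₀₀) = C • μ_hyp`; A-p06 (g29) FILE 5: `C = π²∕2`): for every `f ∈ C¹_c(M₂(ℂ), E)` and `z ∈ S¹`,
`lim_{ψ → 0, ψ ≠ 0} ∂_ψ [2 sin ψ · ∫ f(h·diag(z e^{iψ}, z e^{−iψ})·h⁻¹) d(archLocalTopFormHaar L 2 (diagonal a) w)(h)] = (−π·C) • f(z•1)`, and the normalised orbital integral is
differentiable for `0 < |ψ| < 1`.  (§1 transport along the datum of `exists_conj_map_archLocalTopFormHaar_eq_std`, the carrier rewrite `σ_w(diag(1,−1)) = diag(1,−1)`, §2.)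
With `C = π²∕2`: the constant is `−π³∕2 = −V₂` (★ A-p12 (g20) `lintegral_cayleyWeightC_two`), so U4's (nc) constant `V₁ · C_R1G = −π⁴∕2 = −V₂·V₁`.
[cite: Varadarajan1989, §6.4 Thm 22] [cite: Rogawski1990, §8.2 Prop. 8.2.1 p. 118; §1.7 p. 6] [cite: Helgason2000, Introduction §4 Thm. 4.2] -/
theorem tendsto_deriv_two_sin_smul_orbitalIntegral_archLocalTopFormHaar (w : {w : InfinitePlace L // IsComplex w}) (a : Fin 2 → L) (ha : ∀ i, a i ≠ 0)
    (hreal : ∀ i, (w.1.embedding (a i)).im = 0) (hsgn : (w.1.embedding (a 0)).re * (w.1.embedding (a 1)).re < 0)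
    [MeasurableSpace (GL (Fin 2) ℂ)] [BorelSpace (GL (Fin 2) ℂ)] (C : ℝ≥0)
    (hC : (localTopFormHaar 2 (Matrix.diagonal ![(1 : ℂ), -1])).map
        (fun h : unitaryGroupOfForm (starRingEnd ℂ) (Matrix.diagonal ![(1 : ℂ), -1]) => discMoebius ((h : GL (Fin 2) ℂ) : Matrix (Fin 2) (Fin 2) ℂ) 0) =
      C • discHyperbolicMeasure)
    (f : Matrix (Fin 2) (Fin 2) ℂ → E) (hf : ContDiff ℝ 1 f) (hfc : HasCompactSupport f) (z : Circle) :
    Tendsto (fun ψ : ℝ => deriv (fun ψ : ℝ => (2 * Real.sin ψ) •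
        ∫ h : unitaryGroupOfForm (starRingEnd ℂ) ((Matrix.diagonal a).map w.1.embedding),
          f (((h * ⟨circleDiagonal 2 ![z * Circle.exp ψ, z * Circle.exp (-ψ)], circleDiagonal_mem_archLocal_diagonal L 2 a w _⟩ * h⁻¹ :
            unitaryGroupOfForm (starRingEnd ℂ) ((Matrix.diagonal a).map w.1.embedding)) : GL (Fin 2) ℂ) : Matrix (Fin 2) (Fin 2) ℂ)
          ∂(archLocalTopFormHaar L 2 (Matrix.diagonal a) w)) ψ)
      (𝓝[≠] 0) (𝓝 ((-(π * C)) • f ((z : ℂ) • (1 : Matrix (Fin 2) (Fin 2) ℂ)))) ∧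
    ∀ ψ ∈ Ioo (-1 : ℝ) 1, ψ ≠ 0 → DifferentiableAt ℝ (fun ψ : ℝ => (2 * Real.sin ψ) •
        ∫ h : unitaryGroupOfForm (starRingEnd ℂ) ((Matrix.diagonal a).map w.1.embedding),
          f (((h * ⟨circleDiagonal 2 ![z * Circle.exp ψ, z * Circle.exp (-ψ)], circleDiagonal_mem_archLocal_diagonal L 2 a w _⟩ * h⁻¹ :
            unitaryGroupOfForm (starRingEnd ℂ) ((Matrix.diagonal a).map w.1.embedding)) : GL (Fin 2) ℂ) : Matrix (Fin 2) (Fin 2) ℂ)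
          ∂(archLocalTopFormHaar L 2 (Matrix.diagonal a) w)) ψ := by
  obtain ⟨T, d, hTd, Φ, hΦ, hmap⟩ := exists_conj_map_archLocalTopFormHaar_eq_std L w a ha hreal hsgn
  have hstd : (Matrix.diagonal ![(1 : L), -1]).map w.1.embedding = Matrix.diagonal ![(1 : ℂ), -1] := by
    rw [diagonal_map_embedding]
    congr 1; funext i; fin_cases i <;> simp
  -- the transport datum, restated on the VERBATIM standard carrier `diag(1,−1)` (rewrite `σ_w(diag(1,−1)) = diag(1,−1)` in all its occurrences)
  -- (everything at the `archLocal` spelling of `U(σ_w diag a)(ℂ)`, the one carried by `archLocalTopFormHaar`'s type)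
  have key : ∀ (J : Matrix (Fin 2) (Fin 2) ℂ), (Matrix.diagonal ![(1 : L), -1]).map w.1.embedding = J →
      ∃ Φ' : archLocal L 2 (Matrix.diagonal a) w ≃ₜ* unitaryGroupOfForm (starRingEnd ℂ) J,
        (∀ g : archLocal L 2 (Matrix.diagonal a) w,
          ((Φ' g : unitaryGroupOfForm (starRingEnd ℂ) J) : GL (Fin 2) ℂ) = T * (g : GL (Fin 2) ℂ) * T⁻¹) ∧
        Measure.map Φ' (archLocalTopFormHaar L 2 (Matrix.diagonal a) w) = localTopFormHaar 2 J := by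
    rintro J rfl
    exact ⟨Φ, hΦ, hmap⟩
  obtain ⟨Φ', hΦ', hmap'⟩ := key _ hstd
  -- §2 for the transported measure, then §1
  -- (instances at the `archLocal` spelling of `S′ = U(σ_w diag a)(ℂ)`, the one carried by `archLocalTopFormHaar`'s type)
  refine tendsto_deriv_orbitalIntegral_transport_explicit (E := E) (unitaryGroupOfForm (starRingEnd ℂ) (Matrix.diagonal ![(1 : ℂ), -1]))
    (archLocal L 2 (Matrix.diagonal a) w)
    (fun w' => circleDiagonal_mem_unitaryGroupOfForm_diagonal 2 w' _) (fun w' => circleDiagonal_mem_archLocal_diagonal L 2 a w w')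
    Φ' T hΦ' (diagonal_mul_circleDiagonal_comm' T d hTd) (archLocalTopFormHaar L 2 (Matrix.diagonal a) w) (-(π * C)) ?_ f hf hfc z
  intro f' hf' hfc' z'
  rw [hmap']
  exact tendsto_deriv_two_sin_smul_orbitalIntegral_of_map_chart (E := E) (localTopFormHaar 2 (Matrix.diagonal ![(1 : ℂ), -1])) C hC f' hf' hfc' z'

end CM

end Literature.NumberTheory.Automorphic.UnitaryGroup

end
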